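import Summits.BirchSwinnertonDyer.BirchSwinnertonDyer.Theorems.ByReductionTypeAtTwoTowerLayerGoodHolds
import Literature.NumberTheory.EllipticCurves.Greenberg1999.ControlLocalKernelsLayerPTorsionProofs
import HarnessLib

/-!
# The TOWER doors with `h33g` AND `hA` DISCHARGED: the universal local constant `C_ℓ = 4` is a
# kernel theorem (route ByReductionTypeAtTwo, crux `OrdKatoHalfAtTwo`, item stmt-BirchSwinnertonDyer-19271;
# seat bsd-2adic-tower-1 GEN 3, part 14a: the odd-place constant and the numeric / rational-prime gap)

HONEST FRAMING (cell `bsd-2adic`, run/shared/lean/pub/bsd-2adic/, HUMAN RULINGS D-0036/D-0074): THEOREMS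
ONLY; nothing asserted; no definition; no new named fact; closes nothing by itself.

Parts 7–13 display the PRINT binders `h33g` (L.3.3 good), `hM` (L.3.3 p. 88 multiplicative), `hA` (L.3.3
p. 88 additive: `#ker ≤ 4`) and `hS34` (L.3.4 structure at `2`). Two of them are now THEOREMS of the tree
(this seat): `lemma33_localTowerKerPrimary_eq_bot_of_good_holds` (good `ℓ ≠ 2`, all layers; file
`Greenberg1999/ControlLocalKernelsLayerGoodProofs`) and the UNIVERSAL bound
`finite_and_natCard_pTorsion_localTowerKerPrimary_le_sq` — `#𝒦_{v,n}[p] ≤ p²` at EVERY `v ∤ p`, every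
layer, ANY reduction type (file `Greenberg1999/ControlLocalKernelsLayerPTorsionProofs`), which is all that
the `4 ≤ C_ℓ` disjunct of the certificate ever used `hA` for. Parts 14a (this file) and 14b (`…TowerLayerUniversalDoors`) re-derive the chain
numeric → nat → cert → doors with ONLY `hM` and `hS34` as local PRINT binders:

* `pTorsion_localTowerKer_le_of_numeric_univ` — the odd-place constant: `4` (kernel theorem, any type),
  `2` (`hM`, multiplicative), `1` (`hM` + `2 ∤ ord_ℓ Δ_min`, or good: kernel theorem);
* `towerGapAtTwo_of_layerSelmer_numeric_univ` / `_nat_univ` / `_cert_univ` / `_cert_upper_univ` — the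
  GAP certificate (two layer counts / one layer count), proofs verbatim from parts 7–9, 11;
* doors: `katoHalfAt_two_of_layerSelmer_cert_gap_univ` / `_upper_gap_univ` (the item `OrdKatoHalfAtTwo`
  AT `W`, any analytic rank; PRINT `h17`, `hM`, `hS34`), `bsdp_two_/mazurMainConjecture_two_of_layerSelmer_cert_univ_of_missingLowerBoundAt`
  (rank `0`, `Ш`-currency; PRINT `hmod`, `hGZK`, `h17`, `hEC`, `hM`, `hS34`).

CERTIFICATE binders unchanged (`hper₀`, odd torsion, `P/hP/hΔ`, `C/e/k` with `he/hC`, layer Selmer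
count(s), closed arithmetic, `MissingLowerBoundAt W 2` for `BSDp`). A class with only ADDITIVE odd bad
primes (all `C_ℓ = 4`) now displays NO Lemma-3.3 binder at all.

References: R. Greenberg, LNM 1716 (1999), §3 Lemmas 3.3–3.5 (PDF pp. 86–90), Prop. 2.5, Thm. 4.1;
K. Kato, Astérisque 295 (2004), Thm. 17.4; J. H. Silverman, AEC VII.1, VII.5.
-/

set_option autoImplicit false

noncomputable section

open scoped Classical MatrixGroups ModularForm

open NumberField IsDedekindDomain CongruenceSubgroup WeierstrassCurve Literature.NumberTheory.EllipticCurves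
  Literature.NumberTheory.EllipticCurves.ModularForms Literature.NumberTheory.EllipticCurves.Rank1Residual
  Literature.NumberTheory.EllipticCurves.Rank1Residual.Typed
  Literature.NumberTheory.EllipticCurves.Greenberg1999
  Literature.NumberTheory.GaloisRepresentations
  Summit.BirchSwinnertonDyer.Rank1Residual.X1.MuLambda
  Summit.BirchSwinnertonDyer.Rank1Residual.X1.MuPart
  Summit.BirchSwinnertonDyer.Rank1Residual.X1.ParitySqueeze
  Summit.BirchSwinnertonDyer.BirchSwinnertonDyer.Theorems.Rank1ResidualX1Defs
  Summit.BirchSwinnertonDyer.Rank1Residual.X5 Summit.BirchSwinnertonDyer.Rank1Residual.X5.O1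
  Summit.BirchSwinnertonDyer.Rank1Residual.X5.TowerGap
  Summit.BirchSwinnertonDyer.Rank1Residual
  Rat.HeightOneSpectrum

namespace Summit.BirchSwinnertonDyer.BirchSwinnertonDyer.Theorems.KatoHalfPinch

section Curve

variable (W : WeierstrassCurve ℚ) [W.IsElliptic] [W.IsGloballyMinimal]


/-! ### The odd-place constant -/

omit [W.IsGloballyMinimal] in
/-- **The local constant at an odd place — `4` PRINT-FREE, `2`/`1` from the p. 88 multiplicative reading `hM`, `1` at good `v` from the tree's theorem.** (As `pTorsion_localTowerKer_le_of_numeric`, without `h33g`/`hA`: the disjunct `4 ≤ C` is the kernel theorem `finite_and_natCard_pTorsion_localTowerKerPrimary_le_sq`, the good case is `lemma33_localTowerKerPrimary_eq_bot_of_good_holds`.) For `W/ℚ` elliptic, `κ` cyclotomic at `2`,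
an odd place `v` and a layer `n`: `#𝒦_{v,n}[2] ≤ C` as soon as ONE of: `4 ≤ C` (any reduction type:
trichotomy + p. 86/88 readings), or `v` multiplicative and `2 ≤ C`, or `v` multiplicative with
`2 ∤ ord_v(Δ_min)` and `1 ≤ C`, or `v` good and `1 ≤ C`.
[cite: GreenbergLNM1716, §3 Lemma 3.3 (PDF pp. 86–88)] -/
theorem pTorsion_localTowerKer_le_of_numeric_univ
    (hM : lemma33_localTowerKerPrimary_cyclic_of_multiplicative.{0})
    (κ : ZpExtension ℚ 2) (hκ : κ.IsCyclotomic) (v : HeightOneSpectrum (𝓞 ℚ))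
    (h2v : ((2 : ℕ) : 𝓞 ℚ) ∉ v.asIdeal) (n C : ℕ)
    (hC : 4 ≤ C ∨ (W.HasMultiplicativeReductionAt v ∧ 2 ≤ C) ∨
      (W.HasMultiplicativeReductionAt v ∧ ¬ 2 ∣ W.ordMinimalDiscriminant v ∧ 1 ≤ C) ∨
      (W.HasGoodReductionAt v ∧ 1 ≤ C)) :
    Finite {x : W.localTowerKerPrimary κ (v.adicCompletion ℚ) n // 2 • x = 0} ∧
      Nat.card {x : W.localTowerKerPrimary κ (v.adicCompletion ℚ) n // 2 • x = 0} ≤ C := by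
  haveI : Fact (Nat.Prime 2) := ⟨Nat.prime_two⟩
  -- the three printed evaluations
  have hgood : W.HasGoodReductionAt v →
      Finite {x : W.localTowerKerPrimary κ (v.adicCompletion ℚ) n // 2 • x = 0} ∧
        Nat.card {x : W.localTowerKerPrimary κ (v.adicCompletion ℚ) n // 2 • x = 0} ≤ 1 :=
    fun hg ↦ finite_and_natCard_pTorsion_le_one_of_eq_bot
      (lemma33_localTowerKerPrimary_eq_bot_of_good_holds ℚ W 2 κ hκ v h2v hg n) 2
  have hmult : W.HasMultiplicativeReductionAt v →
      Finite {x : W.localTowerKerPrimary κ (v.adicCompletion ℚ) n // 2 • x = 0} ∧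
        Nat.card {x : W.localTowerKerPrimary κ (v.adicCompletion ℚ) n // 2 • x = 0} ≤
          (if 2 ∣ W.ordMinimalDiscriminant v then 2 else 1) :=
    fun hm ↦ pTorsion_le_of_lemma33_multiplicative hM W 2 κ hκ v h2v hm n
  have huniv :
      Finite {x : W.localTowerKerPrimary κ (v.adicCompletion ℚ) n // 2 • x = 0} ∧
        Nat.card {x : W.localTowerKerPrimary κ (v.adicCompletion ℚ) n // 2 • x = 0} ≤ 4 := by
    obtain ⟨hf, hle⟩ := finite_and_natCard_pTorsion_localTowerKerPrimary_le_sq W κ h2v n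
    exact ⟨hf, hle.trans (by norm_num)⟩
  have hmult2 : W.HasMultiplicativeReductionAt v →
      Finite {x : W.localTowerKerPrimary κ (v.adicCompletion ℚ) n // 2 • x = 0} ∧
        Nat.card {x : W.localTowerKerPrimary κ (v.adicCompletion ℚ) n // 2 • x = 0} ≤ 2 := by
    intro hm
    obtain ⟨hf, hle⟩ := hmult hm
    refine ⟨hf, hle.trans ?_⟩
    split_ifs <;> omega
  rcases hC with h4 | ⟨hm, h2⟩ | ⟨hm, hodd, h1⟩ | ⟨hg, h1⟩
  · -- any reduction type: the universal bound `#𝒦_{v,n}[2] ≤ 2² = 4`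
    obtain ⟨hf, hle⟩ := huniv; exact ⟨hf, by omega⟩
  · obtain ⟨hf, hle⟩ := hmult2 hm; exact ⟨hf, by omega⟩
  · obtain ⟨hf, hle⟩ := hmult hm
    rw [if_neg hodd] at hle
    exact ⟨hf, by omega⟩
  · obtain ⟨hf, hle⟩ := hgood hg; exact ⟨hf, by omega⟩


/-! ### The GAP certificate (numeric → rational primes → decidable) -/

/-- **The GAP certificate with NUMERIC local constants.** `W/ℚ` good ordinary at `2` with odd torsion
order; layers `j ≤ j'`; `S` a finite set of finite places off which every place is odd and good (`hS`);
PRINT: `hM` (Greenberg L.3.3 p. 88, multiplicative), `hS34` (L.3.4 structure, p. 89) — `h33g`/`hA` DISCHARGED;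
CERTIFICATES: `2^a ≤ #Sel_{2^∞}(E/ℚ_j)[2]`, `#Sel_{2^∞}(E/ℚ_{j'})[2] ≤ 2^d`, a numeric `C_v` at each odd
`v ∈ S` justified by ONE disjunct of `hC` (`4 ≤ C_v` needs nothing), and the arithmetic
`2^d · ∏_{v ∈ S} (2 ∈ v ? 4 : C_v)^{(2 ∈ v ? 1 : 2^{min(j', v₂(ℓ_v² − 1) − 3)})} < 2^{2^{j'} − 2^j + a}`.
Then `O1.TowerGapAtTwo W`. [cite: GreenbergLNM1716, §3 Lemmas 3.3–3.5 (PDF pp. 86–90), Prop. 2.5]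
[cite: Washington1997, §13.1] -/
theorem towerGapAtTwo_of_layerSelmer_numeric_univ
    (hM : lemma33_localTowerKerPrimary_cyclic_of_multiplicative.{0})
    (hS34 : lemma34_localTowerKerPrimary_cyclicExtension_rat)
    (hgo : GoodOrd W 2) (htors : ¬ 2 ∣ W.torsionOrder) {j j' a d : ℕ} (hjj' : j ≤ j')
    (S : Finset (HeightOneSpectrum (𝓞 ℚ)))
    (hS : ∀ v ∉ S, ((2 : ℕ) : 𝓞 ℚ) ∉ v.asIdeal ∧ W.HasGoodReductionAt v)
    (C : HeightOneSpectrum (𝓞 ℚ) → ℕ)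
    (hC : ∀ v ∈ S, ((2 : ℕ) : 𝓞 ℚ) ∉ v.asIdeal →
      4 ≤ C v ∨ (W.HasMultiplicativeReductionAt v ∧ 2 ≤ C v) ∨
        (W.HasMultiplicativeReductionAt v ∧ ¬ 2 ∣ W.ordMinimalDiscriminant v ∧ 1 ≤ C v) ∨
        (W.HasGoodReductionAt v ∧ 1 ≤ C v))
    (hlow : ∀ κ : ZpExtension ℚ 2, κ.IsCyclotomic →
      2 ^ a ≤ Nat.card {z : W.selmerLayer κ j // 2 • z = 0})
    (hup : ∀ κ : ZpExtension ℚ 2, κ.IsCyclotomic →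
      Nat.card {z : W.selmerLayer κ j' // 2 • z = 0} ≤ 2 ^ d)
    (harith : 2 ^ d * ∏ v ∈ S, (if ((2 : ℕ) : 𝓞 ℚ) ∈ v.asIdeal then 4 else C v) ^
        (if ((2 : ℕ) : 𝓞 ℚ) ∈ v.asIdeal then 1
          else 2 ^ min j' (padicValNat 2 (Rat.HeightOneSpectrum.natGenerator v ^ 2 - 1) - 3)) <
      2 ^ (2 ^ j' - 2 ^ j + a)) : TowerGapAtTwo W := by
  refine towerGapAtTwo_of_localKernelBounds_sharp W htors hjj' S
    (fun v ↦ if ((2 : ℕ) : 𝓞 ℚ) ∈ v.asIdeal then 4 else C v) hlow hup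
    (fun κ hκ v hv ↦ lemma33_localTowerKerPrimary_eq_bot_of_good_holds ℚ W 2 κ hκ v (hS v hv).1
      (hS v hv).2 j') (fun κ hκ v hv ↦ ?_) harith
  by_cases h2 : ((2 : ℕ) : 𝓞 ℚ) ∈ v.asIdeal
  · rw [if_pos h2]
    exact pTorsion_localTowerKer_at_two_le_four W hS34 hgo κ hκ v h2 j'
  · rw [if_neg h2]
    exact pTorsion_localTowerKer_le_of_numeric_univ W hM κ hκ v h2 j' (C v) (hC v hv h2)


/-- **The GAP certificate indexed by rational primes.** `W/ℚ` globally minimal, good ordinary at `2`,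
odd torsion order; layers `j ≤ j'`; `P` a finite set of ODD PRIMES containing every odd prime dividing
the minimal discriminant (`hP`, `hΔ`); PRINT `hM`/`hS34` (`h33g`/`hA` discharged); CERTIFICATES: the layer Selmer
counts `hlow`/`hup`, local constants `C : ℕ → ℕ` justified per `ℓ ∈ P` by ONE disjunct of `hC`
(`4 ≤ C ℓ` needs nothing), and the closed arithmetic
`2^d · 4 · ∏_{ℓ ∈ P} C_ℓ^{2^{min(j', v₂(ℓ² − 1) − 3)}} < 2^{2^{j'} − 2^j + a}`. Then `O1.TowerGapAtTwo W`.
[cite: GreenbergLNM1716, §3 Lemmas 3.3–3.5 (PDF pp. 86–90), Prop. 2.5] [cite: SilvermanAEC2009, VII.1 Prop. 1.3, VII.5.1] -/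
theorem towerGapAtTwo_of_layerSelmer_nat_univ
    (hM : lemma33_localTowerKerPrimary_cyclic_of_multiplicative.{0})
    (hS34 : lemma34_localTowerKerPrimary_cyclicExtension_rat)
    (hgo : GoodOrd W 2) (htors : ¬ 2 ∣ W.torsionOrder) {j j' a d : ℕ} (hjj' : j ≤ j')
    (P : Finset ℕ) (hP : ∀ ℓ ∈ P, ℓ.Prime ∧ ℓ ≠ 2)
    (hΔ : ∀ ℓ : ℕ, ℓ.Prime → ℓ ≠ 2 → (ℓ : ℤ) ∣ W.minimalDiscriminantInt → ℓ ∈ P)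
    (C : ℕ → ℕ)
    (hC : ∀ (ℓ : ℕ) [Fact ℓ.Prime], ℓ ∈ P →
      4 ≤ C ℓ ∨ (W.HasMultiplicativeReductionAtPrime ℓ ∧ 2 ≤ C ℓ) ∨
        (W.HasMultiplicativeReductionAtPrime ℓ ∧ ¬ 2 ∣ padicValInt ℓ W.minimalDiscriminantInt ∧
          1 ≤ C ℓ) ∨
        (¬ (ℓ : ℤ) ∣ W.minimalDiscriminantInt ∧ 1 ≤ C ℓ))
    (hlow : ∀ κ : ZpExtension ℚ 2, κ.IsCyclotomic →
      2 ^ a ≤ Nat.card {z : W.selmerLayer κ j // 2 • z = 0})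
    (hup : ∀ κ : ZpExtension ℚ 2, κ.IsCyclotomic →
      Nat.card {z : W.selmerLayer κ j' // 2 • z = 0} ≤ 2 ^ d)
    (harith : 2 ^ d * 4 * ∏ ℓ ∈ P, C ℓ ^ 2 ^ min j' (padicValNat 2 (ℓ ^ 2 - 1) - 3) <
      2 ^ (2 ^ j' - 2 ^ j + a)) : TowerGapAtTwo W := by
  -- the places
  let pl : ℕ → HeightOneSpectrum (𝓞 ℚ) := fun ℓ ↦
    if h : ℓ.Prime then (primesEquiv (R := 𝓞 ℚ)).symm ⟨ℓ, h⟩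
      else (primesEquiv (R := 𝓞 ℚ)).symm ⟨2, Nat.prime_two⟩
  have hpl : ∀ {ℓ : ℕ}, ℓ.Prime → natGenerator (pl ℓ) = ℓ := fun {ℓ} h ↦ by
    simp only [pl, dif_pos h]
    exact congrArg Subtype.val ((primesEquiv (R := 𝓞 ℚ)).apply_symm_apply ⟨ℓ, h⟩)
  have hpl_inj : Set.InjOn pl P := by
    intro ℓ hℓ ℓ' hℓ' h
    have := congrArg natGenerator h
    rwa [hpl (hP ℓ hℓ).1, hpl (hP ℓ' hℓ').1] at this
  let v₂ : HeightOneSpectrum (𝓞 ℚ) := pl 2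
  have hv₂ : natGenerator v₂ = 2 := hpl Nat.prime_two
  have h2v₂ : ((2 : ℕ) : 𝓞 ℚ) ∈ v₂.asIdeal := (natCast_prime_mem_asIdeal_iff v₂ Nat.prime_two).mpr hv₂
  have hv₂_notMem : v₂ ∉ P.image pl := by
    intro h
    obtain ⟨ℓ, hℓ, hℓeq⟩ := Finset.mem_image.mp h
    have := congrArg natGenerator hℓeq
    rw [hpl (hP ℓ hℓ).1, hv₂] at this
    exact (hP ℓ hℓ).2 this
  -- odd places in the image
  have hodd : ∀ {ℓ : ℕ}, ℓ ∈ P → ((2 : ℕ) : 𝓞 ℚ) ∉ (pl ℓ).asIdeal := fun {ℓ} hℓ h ↦ by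
    rw [natCast_prime_mem_asIdeal_iff _ Nat.prime_two, hpl (hP ℓ hℓ).1] at h
    exact (hP ℓ hℓ).2 h
  let S : Finset (HeightOneSpectrum (𝓞 ℚ)) := insert v₂ (P.image pl)
  let Cv : HeightOneSpectrum (𝓞 ℚ) → ℕ := fun v ↦ C (natGenerator v)
  refine towerGapAtTwo_of_layerSelmer_numeric_univ W hM hS34 hgo htors hjj' S ?_ Cv ?_ hlow hup ?_
  · -- `hS`: off `S` every place is odd and good
    intro v hv
    have hgen := prime_natGenerator v
    haveI : Fact (natGenerator v).Prime := ⟨hgen⟩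
    have hvpl : pl (natGenerator v) = v := by
      simp only [pl, dif_pos hgen]
      exact (primesEquiv (R := 𝓞 ℚ)).symm_apply_apply v
    have hne2 : natGenerator v ≠ 2 := by
      intro h
      apply hv
      rw [Finset.mem_insert]
      left
      rw [← hvpl]
      simp only [v₂, h]
    have hnotP : natGenerator v ∉ P := by
      intro h
      exact hv (Finset.mem_insert_of_mem (Finset.mem_image.mpr ⟨_, h, hvpl⟩))
    refine ⟨fun h ↦ hne2 ((natCast_prime_mem_asIdeal_iff v Nat.prime_two).mp h), ?_⟩
    have hndvd : ¬ ((natGenerator v : ℕ) : ℤ) ∣ W.minimalDiscriminantInt :=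
      fun h ↦ hnotP (hΔ _ hgen hne2 h)
    exact (hasGoodReductionAtPrime_iff_hasGoodReductionAt_ringOfIntegers (v := v) W).mp
      (hasGoodReductionAtPrime_of_not_dvd W (natGenerator v) hndvd)
  · -- `hC`: the numeric local constants at the odd places of `S`
    intro v hv h2
    rcases Finset.mem_insert.mp hv with rfl | hv'
    · exact absurd h2v₂ h2
    obtain ⟨ℓ, hℓP, rfl⟩ := Finset.mem_image.mp hv'
    have hℓ := (hP ℓ hℓP).1
    haveI : Fact ℓ.Prime := ⟨hℓ⟩
    have hgen : natGenerator (pl ℓ) = ℓ := hpl hℓ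
    haveI : Fact (Nat.Prime ((primesEquiv (pl ℓ) : Nat.Primes) : ℕ)) := ⟨(primesEquiv (pl ℓ)).2⟩
    have hpe : ((primesEquiv (pl ℓ) : Nat.Primes) : ℕ) = ℓ := hgen
    have hCv : Cv (pl ℓ) = C ℓ := by simp only [Cv, hgen]
    rw [hCv]
    rcases hC ℓ hℓP with h4 | ⟨hm, h2C⟩ | ⟨hm, hord, h1⟩ | ⟨hg, h1⟩
    · exact Or.inl h4
    · refine Or.inr (Or.inl ⟨?_, h2C⟩)
      exact (hasMultiplicativeReductionAtPrime_iff_hasMultiplicativeReductionAt_ringOfIntegers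
        (W := W) (pl ℓ)).mp ((hasMultiplicativeReductionAtPrime_congr W hpe).mpr hm)
    · refine Or.inr (Or.inr (Or.inl ⟨?_, ?_, h1⟩))
      · exact (hasMultiplicativeReductionAtPrime_iff_hasMultiplicativeReductionAt_ringOfIntegers
          (W := W) (pl ℓ)).mp ((hasMultiplicativeReductionAtPrime_congr W hpe).mpr hm)
      · rwa [LocalTorsionMult.ordMinimalDiscriminant_eq_padicValInt W (pl ℓ) hpe]
    · refine Or.inr (Or.inr (Or.inr ⟨?_, h1⟩))
      exact (hasGoodReductionAtPrime_iff_hasGoodReductionAt_ringOfIntegers (v := pl ℓ) W).mp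
        ((hasGoodReductionAtPrime_congr W hpe).mpr (hasGoodReductionAtPrime_of_not_dvd W ℓ hg))
  · -- the arithmetic, re-indexed by primes
    have hprod : ∏ v ∈ S, (if ((2 : ℕ) : 𝓞 ℚ) ∈ v.asIdeal then 4 else Cv v) ^
        (if ((2 : ℕ) : 𝓞 ℚ) ∈ v.asIdeal then 1
          else 2 ^ min j' (padicValNat 2 (natGenerator v ^ 2 - 1) - 3)) =
        4 * ∏ ℓ ∈ P, C ℓ ^ 2 ^ min j' (padicValNat 2 (ℓ ^ 2 - 1) - 3) := by
      rw [Finset.prod_insert hv₂_notMem, if_pos h2v₂, if_pos h2v₂, pow_one,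
        Finset.prod_image hpl_inj]
      congr 1
      refine Finset.prod_congr rfl fun ℓ hℓ ↦ ?_
      rw [if_neg (hodd hℓ), if_neg (hodd hℓ)]
      simp only [Cv, hpl (hP ℓ hℓ).1]
    rw [hprod, ← mul_assoc]
    exact harith

end Curve

end Summit.BirchSwinnertonDyer.BirchSwinnertonDyer.Theorems.KatoHalfPinch

end
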